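import Summits.QuantumFields.YangMills.Theorems.UnitScaleTiltProp7Op139OfGaugeColumn
import HarnessLib

/-!
# LIFT-THREAD 2 (★★OWNER RULING №30; namer ★w2-19200 g9 PEN ASSIGNMENT v1 17:22:48Z «px12 g11: T1»; token convention (α)(β)(γ) 17:25:31Z) — T1 door twin of
# ✓`UnitScaleTiltProp7Op139OfGaugeColumn`: the theorems `hOp139π_of_gaugeColumn_family` VERBATIM with the OPAQUE predicate binder
# `(Lift : ∀ (L : ℕ) (i : Idx L), GaugeField (i.1.1.P i.1.2.2) 0 (Matrix.specialUnitaryGroup (Fin 2) ℂ) → Prop)` (first explicit binder) and the antecedent `Lift L i U₀ →` inserted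
# immediately after the last regularity guard (`RegPr … (α L) U₀ →` ∕ `ρ ≤ α L →`) in the N06-derived rows `hPcol` AND in the op-shaped conclusion; proofs = v1's with
# `hLift` introduced and passed through.  Letters of the v1 file are used BY NAME (imported, not restated).

Cell `ym3-torus`, width seat `ym3-torus-px12` (gen 11).  THEOREMS ONLY (0 `def`, 0 `sorry`); `--supports stmt-QuantumFields-19200 --as helper`, count-neutral.  WHY: px12 g11 LOCATE
«STRATUM (c) AND THE 13 N06 ROWS» (19200 evidence n = 49) + ✓p734809 `Prop7PcolImpliesNSPoincare`: the intrinsic `R_S`-rows of the EX display are inhabitable only on the lift locus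
(`U₀` whose top-level parallel sections lift), so the display S43ᴸT2 carries `Lift L i U₀ →` on the 13 print rows and every door between the display and the junction threads it.
HONEST SCOPE: bookkeeping twin; nothing of print asserted beyond the v1 file; no row, stub or crux is proved; YM₃ on T³ = rung R3 — NOT d = 4, NOT infinite volume, NOT a mass gap, NOT Clay.
References: as in ✓`UnitScaleTiltProp7Op139OfGaugeColumn` (T. Bałaban, CMP 99 (1985) 389–434 [Balaban1985BackgroundPropagators]; CMP 102 (1985) 277–309 [Balaban1985Variational]).
-/

set_option autoImplicit false

noncomputable section

open scoped Matrix.Norms.L2Operator BigOperators InnerProductSpace ComplexConjugate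
open Complex (I)


open Literature.MathematicalPhysics.QuantumFieldTheory.Balaban1983to89
open Literature.MathematicalPhysics.QuantumFieldTheory.Balaban1983to89.T3ContinuumYM3Torus
open Literature.MathematicalPhysics.QuantumFieldTheory.Balaban1983to89.T3Thm1Carrier
open T3PrintedRegularMinimiser (RegPr)
open T3SectALandauChart (formComp bgUnits eta eta_pos)
open B9TorusCalculus (torusT)
open B9Eq39Adjoint (R bondPair J)
open Beta.BackgroundVertices (ad)
open B11Eq103H1Complex (SiteL2K BondL2K)
open Summit.QuantumFields.YangMills.Theorems.Prop7SectET3Transport (periodsT3)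
open Summit.QuantumFields.YangMills.Theorems.Prop7SectET3HilbertLetters (W₂ frobEquiv toL2 toL2S inner_toL2 inner_frobEquiv_symm DL2 DstarL2)
open Summit.QuantumFields.YangMills.Theorems.Prop7SectET3GaugeProjector (RS)
open Summit.QuantumFields.YangMills.Theorems.Prop7SectET3WilsonHessian (DeltaEta)
open Summit.QuantumFields.YangMills.Theorems.Prop7SectET3DeltaPiPInv (GprimeP DeltaPiP DeltaPiSlotP DeltaPiSlotP_apply)
open Summit.QuantumFields.YangMills.Theorems.Prop7RieszTauFrobNorm (norm_le_norm_frobEquiv_symm)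
open Summit.QuantumFields.YangMills.Theorems.Prop7DeltaPiDefectPairing (inner_DL2_toL2S_DeltaEta_toL2 inner_DeltaEta_sub_DeltaPiP_of_landau norm_bondPair_linJ_le norm_J_one_le_of_regPr)



variable {F : T3Family} {K : ℕ} {c₀ : ℝ}

namespace Summit.QuantumFields.YangMills.Theorems.Prop7Op139OfGaugeColumnLift

open Summit.QuantumFields.YangMills.Theorems.Prop7Op139OfGaugeColumn

/-- ★★★ **DOOR «OPROW-139»: S22ᴸ's DISPLAYED SLOT-DEFECT ROW `hOp139′π` TOKEN FOR TOKEN, `k139π L := 12·α L·p L`**, from the displayed-to-be residue row `hPcol` — «the gauge function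
`G′ᴾR_SD*A` of a ONE-BOND field `A = δ_bd·E` has ℓ¹-mass `≤ p(L)·‖E‖`» ([Balaban1985Variational] p.299 l.6 «`G′RD*` is a bounded operator in the norm |·|₍₁₎» ∘ [Balaban1985BackgroundPropagators]
(3.42), (3.49) — derived operator-norm form; `K`-uniform, `p` L-only; η-free by the dipole count) — via print's (138): FILE D1's ✓`inner_DeltaEta_sub_DeltaPiP_of_landau` +
✓`inner_DL2_toL2S_DeltaEta_toL2` + ✓`norm_bondPair_linJ_le` + ✓`norm_J_one_le_of_regPr` (the DIVERGENCE clause of `RegPr`: `‖J₁‖ ≤ αη³`) and Frobenius duality.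
[cite: Balaban1985Variational, (138)–(139) p.299, (2) p.278, (28) p.282; Balaban1985BackgroundPropagators, (3.117)–(3.120) p.419, (3.42) p.397, (3.49) p.399] -/
theorem hOp139π_of_gaugeColumn_family
    (Lift : ∀ (L : ℕ) (i : Idx L), GaugeField (i.1.1.P i.1.2.2) 0 (Matrix.specialUnitaryGroup (Fin 2) ℂ) → Prop)
    (α : ℕ → ℝ) (hα : ∀ L, 1 < L → 0 ≤ α L) (c₀ cB : ℕ → ℝ) [hc₀ : ∀ L : ℕ, Fact (0 < c₀ L)] [hcB : ∀ L : ℕ, Fact (0 < cB L)] (a : ∀ L : ℕ, Idx L → ℝ)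
    (p : ℕ → ℝ) (hp : ∀ L, 1 < L → 0 ≤ p L)
    (hPcol : ∀ (L : ℕ), 1 < L → ∀ (i : Idx L) (U₀ : GaugeField (i.1.1.P i.1.2.2) 0 (Matrix.specialUnitaryGroup (Fin 2) ℂ)), RegPr i.1.1 i.1.2.1 i.1.2.2 (α L) U₀ → Lift L i U₀ →
      ∀ (bd : PBond (i.1.1.P i.1.2.2) 0) (E : Matrix (Fin 2) (Fin 2) ℂ),
        ∑ x : Site (i.1.1.P i.1.2.2) 0, ‖(toL2S i.1.1 i.1.2.2 (c₀ L)).symm (GprimeP i.1.1 i.1.2.1 i.1.2.2 i.2.2.le (c₀ L) (cB L) (a L i) U₀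
          (RS i.1.1 i.1.2.1 i.1.2.2 i.2.2.le (c₀ L) (cB L) U₀ (DstarL2 i.1.1 i.1.2.1 i.1.2.2 (c₀ L) U₀ (toL2 i.1.1 i.1.2.2 (c₀ L) (Pi.single bd E))))) x‖ ≤ p L * ‖E‖) :
    ∀ (L : ℕ), 1 < L → ∀ (i : Idx L) (U₀ : GaugeField (i.1.1.P i.1.2.2) 0 (Matrix.specialUnitaryGroup (Fin 2) ℂ)), RegPr i.1.1 i.1.2.1 i.1.2.2 (α L) U₀ → Lift L i U₀ →
      ∀ (X : PBond (i.1.1.P i.1.2.2) 0 → Matrix (Fin 2) (Fin 2) ℂ) (s : ℝ), RS i.1.1 i.1.2.1 i.1.2.2 i.2.2.le (c₀ L) (cB L) U₀ (DstarL2 i.1.1 i.1.2.1 i.1.2.2 (c₀ L) U₀ (toL2 i.1.1 i.1.2.2 (c₀ L) X)) = 0 → (∀ bd, ‖X bd‖ ≤ s) →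
        ∀ bd : PBond (i.1.1.P i.1.2.2) 0, ‖(toL2 i.1.1 i.1.2.2 (c₀ L)).symm (DeltaEta i.1.1 i.1.2.1 i.1.2.2 (c₀ L) U₀ (toL2 i.1.1 i.1.2.2 (c₀ L) X) - (DeltaPiSlotP i.1.1 i.1.2.1 i.1.2.2 i.2.2.le (c₀ L) (cB L) (a L i)) U₀ (toL2 i.1.1 i.1.2.2 (c₀ L) X)) bd‖ ≤ (12 * α L * p L) * s := by
  intro L hL i U₀ hreg hLift X s hLan hX bd
  have hs : 0 ≤ s := (norm_nonneg _).trans (hX bd)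
  have hc₀ : 0 < c₀ L := Fact.out
  have hη : 0 < eta i.1.1 i.1.2.1 i.1.2.2 := eta_pos _ _ _
  -- the defect field `G` and its value `E` at `bd`
  set G : PBond (i.1.1.P i.1.2.2) 0 → Matrix (Fin 2) (Fin 2) ℂ :=
    (toL2 i.1.1 i.1.2.2 (c₀ L)).symm (DeltaEta i.1.1 i.1.2.1 i.1.2.2 (c₀ L) U₀ (toL2 i.1.1 i.1.2.2 (c₀ L) X)
      - (DeltaPiSlotP i.1.1 i.1.2.1 i.1.2.2 i.2.2.le (c₀ L) (cB L) (a L i)) U₀ (toL2 i.1.1 i.1.2.2 (c₀ L) X)) with hG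
  set E : Matrix (Fin 2) (Fin 2) ℂ := G bd with hE
  -- the gauge function of the one-bond test field
  set μ : Site (i.1.1.P i.1.2.2) 0 → Matrix (Fin 2) (Fin 2) ℂ := (toL2S i.1.1 i.1.2.2 (c₀ L)).symm
    (GprimeP i.1.1 i.1.2.1 i.1.2.2 i.2.2.le (c₀ L) (cB L) (a L i) U₀ (RS i.1.1 i.1.2.1 i.1.2.2 i.2.2.le (c₀ L) (cB L) U₀
      (DstarL2 i.1.1 i.1.2.1 i.1.2.2 (c₀ L) U₀ (toL2 i.1.1 i.1.2.2 (c₀ L) (Pi.single bd E))))) with hμ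
  have hμsum : ∑ x : Site (i.1.1.P i.1.2.2) 0, ‖μ x‖ ≤ p L * ‖E‖ := hPcol L hL i U₀ hreg hLift bd E
  -- (1) testing `toL2 G` against `δ_bd·E` gives `c₀·‖E‖_F²`
  have h1 : ⟪toL2 i.1.1 i.1.2.2 (c₀ L) (Pi.single bd E), toL2 i.1.1 i.1.2.2 (c₀ L) G⟫_ℂ = (c₀ L : ℂ) * ((‖(frobEquiv.symm E : W₂)‖ : ℂ) ^ 2) := by
    rw [inner_toL2_single_left, ← hE, ← inner_frobEquiv_symm, inner_self_eq_norm_sq_to_K]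
    exact rfl
  -- (2) the same pairing through (138): Landau algebra, then the member reading
  have h2 : ⟪toL2 i.1.1 i.1.2.2 (c₀ L) (Pi.single bd E), toL2 i.1.1 i.1.2.2 (c₀ L) G⟫_ℂ
      = (c₀ L : ℂ) * ((((eta i.1.1 i.1.2.1 i.1.2.2)⁻¹ ^ 3 : ℝ) : ℂ)) * (2 : ℂ)⁻¹ *
          bondPair 1 3 (Matrix.traceLinearMap (Fin 2) ℂ ℂ)
            (fun κ x => I • ad (star μ x) (formComp X κ x) - I • ad (formComp X κ x) (R (bgUnits i.1.1 i.1.2.2 U₀ ⟨x, κ⟩) (star μ (torusT (i.1.1.P i.1.2.2) 0 κ x))))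
            (J (torusT (i.1.1.P i.1.2.2) 0) (fun κ x => bgUnits i.1.1 i.1.2.2 U₀ ⟨x, κ⟩) 1) := by
    rw [hG, LinearEquiv.apply_symm_apply, inner_sub_right, DeltaPiSlotP_apply, inner_DeltaEta_sub_DeltaPiP_of_landau U₀ _ _ hLan]
    have hμ' : GprimeP i.1.1 i.1.2.1 i.1.2.2 i.2.2.le (c₀ L) (cB L) (a L i) U₀ (RS i.1.1 i.1.2.1 i.1.2.2 i.2.2.le (c₀ L) (cB L) U₀
        (DstarL2 i.1.1 i.1.2.1 i.1.2.2 (c₀ L) U₀ (toL2 i.1.1 i.1.2.2 (c₀ L) (Pi.single bd E)))) = toL2S i.1.1 i.1.2.2 (c₀ L) μ := by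
      rw [hμ, LinearEquiv.apply_symm_apply]
    rw [hμ', inner_DL2_toL2S_DeltaEta_toL2]
  -- (3) the pairing estimate with the divergence clause
  have hF' : ∀ (κ : Fin (i.1.1.P i.1.2.2).d) (x : Site (i.1.1.P i.1.2.2) 0), ‖formComp X κ x‖ ≤ s := fun κ x => hX ⟨x, κ⟩
  have hJ' : ∀ (κ : Fin (i.1.1.P i.1.2.2).d) (x : Site (i.1.1.P i.1.2.2) 0),
      ‖J (torusT (i.1.1.P i.1.2.2) 0) (fun κ x => bgUnits i.1.1 i.1.2.2 U₀ ⟨x, κ⟩) 1 κ x‖ ≤ α L * eta i.1.1 i.1.2.1 i.1.2.2 ^ 3 :=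
    fun κ x => norm_J_one_le_of_regPr U₀ hreg κ x
  have h3 := norm_bondPair_linJ_le U₀ (star μ) (formComp X) _ hF' hJ'
  have hstar : ∑ x : Site (i.1.1.P i.1.2.2) 0, ‖(star μ) x‖ = ∑ x : Site (i.1.1.P i.1.2.2) 0, ‖μ x‖ :=
    Finset.sum_congr rfl fun x _ => by rw [Pi.star_apply, norm_star]
  rw [hstar] at h3
  -- (4) compare the two readings in norm
  have hnorm1 : ‖⟪toL2 i.1.1 i.1.2.2 (c₀ L) (Pi.single bd E), toL2 i.1.1 i.1.2.2 (c₀ L) G⟫_ℂ‖ = c₀ L * ‖(frobEquiv.symm E : W₂)‖ ^ 2 := by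
    rw [h1, norm_mul, norm_pow, Complex.norm_real, Complex.norm_real, Real.norm_of_nonneg hc₀.le, Real.norm_of_nonneg (norm_nonneg _)]
  have hnorm2 : ‖⟪toL2 i.1.1 i.1.2.2 (c₀ L) (Pi.single bd E), toL2 i.1.1 i.1.2.2 (c₀ L) G⟫_ℂ‖ ≤ c₀ L * (12 * α L * p L * s * ‖E‖) := by
    rw [h2, norm_mul, norm_mul, norm_mul, Complex.norm_real, Complex.norm_real, Real.norm_of_nonneg hc₀.le, Real.norm_of_nonneg (by positivity), norm_inv,
      Complex.norm_ofNat]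
    have hB := h3.trans (mul_le_mul_of_nonneg_left hμsum (by have := hα L hL; positivity))
    -- `c₀·η⁻³·½·(24·s·(αη³)·(p‖E‖)) = 12·c₀·α·p·s·‖E‖`
    have hηη : (eta i.1.1 i.1.2.1 i.1.2.2)⁻¹ ^ 3 * eta i.1.1 i.1.2.1 i.1.2.2 ^ 3 = 1 := by
      rw [← mul_pow, inv_mul_cancel₀ hη.ne', one_pow]
    calc c₀ L * (eta i.1.1 i.1.2.1 i.1.2.2)⁻¹ ^ 3 * 2⁻¹ * ‖bondPair 1 3 (Matrix.traceLinearMap (Fin 2) ℂ ℂ)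
            (fun κ x => I • ad (star μ x) (formComp X κ x) - I • ad (formComp X κ x) (R (bgUnits i.1.1 i.1.2.2 U₀ ⟨x, κ⟩) (star μ (torusT (i.1.1.P i.1.2.2) 0 κ x))))
            (J (torusT (i.1.1.P i.1.2.2) 0) (fun κ x => bgUnits i.1.1 i.1.2.2 U₀ ⟨x, κ⟩) 1)‖
        ≤ c₀ L * (eta i.1.1 i.1.2.1 i.1.2.2)⁻¹ ^ 3 * 2⁻¹ * (24 * s * (α L * eta i.1.1 i.1.2.1 i.1.2.2 ^ 3) * (p L * ‖E‖)) :=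
          mul_le_mul_of_nonneg_left hB (by positivity)
      _ = c₀ L * (12 * α L * p L * s * ‖E‖) * ((eta i.1.1 i.1.2.1 i.1.2.2)⁻¹ ^ 3 * eta i.1.1 i.1.2.1 i.1.2.2 ^ 3) := by ring
      _ = c₀ L * (12 * α L * p L * s * ‖E‖) := by rw [hηη, mul_one]
  -- (5) `‖E‖ ≤ ‖E‖_F`, `‖E‖_F² ≤ 12αps·‖E‖` ⟹ `‖E‖ ≤ 12αps`
  have hsq : ‖(frobEquiv.symm E : W₂)‖ ^ 2 ≤ (12 * α L * p L * s) * ‖E‖ := by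
    have := hnorm1.symm.le.trans hnorm2
    nlinarith [this, hc₀]
  have hC : 0 ≤ 12 * α L * p L * s := by have := hα L hL; have := hp L hL; positivity
  exact le_of_sq_le_mul (norm_nonneg E) hC (norm_le_norm_frobEquiv_symm E) hsq


end Summit.QuantumFields.YangMills.Theorems.Prop7Op139OfGaugeColumnLift

end
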